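import Literature.Geometry.Symplectic.CanonicalSpincStructure
import Literature.Geometry.GaugeTheory.AdaptedFramesQuasiKaehler
import Literature.Geometry.GaugeTheory.SeibergWittenPerturbationSpace
import Literature.Geometry.GaugeTheory.SeibergWittenChartIndependence
import HarnessLib

/-!
# Taubes's canonical configuration `(A, √r·u₀)` on a symplectic `4`-manifold and the perturbed
# Seiberg–Witten equations it solves (Taubes 1994, §1 (5); Taubes 1995, §5 Step 1, (5.2))

Topic `Literature/Geometry/Symplectic`; continues `CanonicalSpincStructure` (the canonical `Spin^c`
structure `𝔰_J = h.canonicalSpincStructure hs hnd` of `(N, s, J)` over `(N, g_J, o_s)`, in whose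
unitary frames `s = e⁰¹ + e²³` and `ρ⁺(s) = diag(2i, -2i)`; the perturbations `r · s`),
`Literature/Geometry/GaugeTheory/AdaptedFramesCanonicalSpinor` (the canonical spinor `u₀`, a
global unit section of the trivial summand `I ⊂ S⁺ = K⁻¹ ⊕ I`) and
`Literature/Geometry/GaugeTheory/SeibergWittenPerturbationSpace` (the vector space of perturbations).

C. H. Taubes, *The Seiberg–Witten invariants and symplectic forms*, Math. Res. Lett. 1 (1994), §1
(pp. 810–811): "The form `ω` defines the splitting; the summand `I` is an eigenspace for Clifford
multiplication by `ω` with eigenvalue `-i`.  The summand `K⁻¹` has eigenvalue `+i`" (for `|ω|² = ½`);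
"(4) `D_A ψ = 0`, `P₊F_A = i·(|α|² - |β|²)·ω - i·(α*β + αβ*)` … consider instead the perturbed
Seiberg–Witten equation which reads (5) `D_A ψ = 0`, `P₊F_A = P₊F_{A₀} + i·(|α|² - |β|² - 1)·ω - i·(α*β + αβ*)`
… The advantage of (5) over (4) is that the pair `(A₀, u₀)` is, by construction, a solution to (5)."
C. H. Taubes, *The Seiberg–Witten and Gromov invariants*, Math. Res. Lett. 2 (1995), §5 Step 1
(p. 233): "take `r > 0` and consider … the perturbed Seiberg–Witten equation for the pair `(A, ψ)` …
(5.2) `D_A ψ = 0` and `P₊F_A = ¼ τ(ψ ⊗ ψ*) + P₊F_{A₀} - (ir/4)·ω`."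

## What is PROVED (0 named facts)

For `𝔰_J` and Taubes's spinor `u₀ = h.canonicalSpinor hs hnd` (a positive smooth spinor field of
unit length, nowhere zero):

* **the eigen-splitting of `S⁺` under `s`** in the tree's normalisation `|s| = √2`
  (`plusAction_symplectic_mulVec_plusUnit/detUnit`): `ρ⁺(s) u₀ = -2i u₀` (the summand `I`) and
  `ρ⁺(s) u₁ = +2i u₁` (the summand `K⁻¹`);
* **the algebraic identity behind Step 1**, `q(c·u₀) = i ρ⁺((|c|²/4)·s)` (`spinorQuad_canonical_eq`):
  the quadratic term of the curvature equation at `ψ = c·u₀` is Clifford multiplication by the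
  self-dual form `(|c|²/4)·s` — with `c = √r` this is Taubes's term `(ir/4)·ω` of (5.2);
* hence for the **canonical configuration `(A, c·u₀)`** (`canonicalConfiguration`, irreducible for
  `c ≠ 0`) of ANY unitary connection `A` on `det P̃ = K⁻¹` and ANY perturbation `η`: the curvature
  equation `F_A⁺ = q(c u₀) + iη'` with `η' = η - (|c|²/4)·s` holds at a point iff `ρ⁺(F_A) = ρ⁺(η)`
  there, i.e. iff the reducible `(A, 0)` solves `(SW_η)` there
  (`curvatureEquationAt_canonicalConfiguration_iff`), and the Dirac equation for `c·u₀` is that for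
  `u₀` (`dirac_canonicalConfiguration`);
* **Taubes's canonical solution** (`isSolution_canonicalConfiguration`): if `η_A` is a perturbation
  with `ρ⁺(F_A) = ρ⁺(η_A)` on every chart (the self-dual part of the curvature of `A`, packaged as a
  perturbation: `(A, 0)` solves `(SW_{η_A})`) and `∂_A u₀ = 0`, then for every `c` the configuration
  `(A, c·u₀)` SOLVES the Seiberg–Witten equations with perturbation `η_A - (|c|²/4)·s` — for Taubes's
  connection `A = A₀` (whose local forms and gauge law are in `AdaptedFramesCanonicalSpinor`; `∂_{A₀} u₀ = 0`
  is his Lemma 1, `dω = 0`) and `c = √r` this is exactly "(A₀, √r u₀) solves (5.2)", the starting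
  point of both `SW(K⁻¹) = ±1` (Taubes 1994) and `SW ⇒ Gr` (Taubes 1995, §5).

* **Taubes's connection `A₀` of `(N, s, J)`** (`taubesConnection`, the canonical connection of the
  unitary adapted frames, `Literature/Geometry/GaugeTheory/AdaptedFramesCanonicalConnection`): a
  unitary connection on `det P̃ = K⁻¹` with `∇̃^{A₀}_v u₀ = b(v) u₁` (the `I`-component of `∇̃^{A₀} u₀`
  vanishes), unique with this property among unitary connections on `K⁻¹` (`taubesConnection_unique`),
  and the canonical solution for `A = A₀` (`isSolution_canonicalConfiguration_taubesConnection`,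
  modulo `∂_{A₀} u₀ = 0`, i.e. Taubes's Lemma 1, and the packaging `η₀` of `F⁺_{A₀}`).

What is NOT here: Taubes's Lemma 1 (`∂_{A₀} u₀ = 0 ⟺ dω = 0`; the Dirac condition is reduced to the
type-`(0,1)` condition on the torsion `b`, `dirac_taubesConnection_canonicalSpinor_eq_zero_iff`); the
packaging of `F⁺_{A₀}` as a perturbation (it enters as the hypothesis `η₀`).

## References

* C. H. Taubes, *The Seiberg–Witten invariants and symplectic forms*, Math. Res. Lett. 1 (1994)
  809–822, §1 (pp. 810–811, equations (4), (5)). [Taubes1994]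
* C. H. Taubes, *The Seiberg–Witten and Gromov invariants*, Math. Res. Lett. 2 (1995) 221–238,
  §5 Step 1 ((5.1), (5.2), p. 233). [Taubes1995]
* J. W. Morgan, *The Seiberg–Witten Equations and Applications to the Topology of Smooth
  Four-Manifolds*, Princeton Math. Notes 44 (1996), §6.1, §7.1 (7.1)–(7.2). [MorganSWBook1996]
-/

noncomputable section

open scoped Manifold ContDiff EuclideanSpace ComplexConjugate
open Complex Literature.Geometry.Kaehler Literature.Geometry.GaugeTheory Literature.Topology.FourManifolds
open Literature.Geometry.Lorentzian (PseudoRiemannianMetric)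

namespace Literature.Geometry.Symplectic

namespace AlmostComplexStructure.IsCompatibleWith

variable {N : Type*} [TopologicalSpace N] [ChartedSpace (EuclideanSpace ℝ (Fin 4)) N]
  [IsManifold (𝓡 4) ∞ N] {J : AlmostComplexStructure (𝓡 4) ∞ N} {s : MForm (𝓡 4) N ℝ 2}
  (h : J.IsCompatibleWith s) (hs : IsSmoothForm s)
  (hnd : ∀ x (v : TangentSpace (𝓡 4) x), v ≠ 0 → ∃ w : TangentSpace (𝓡 4) x, s x ![v, w] ≠ 0)

/-! ### Taubes's spinor `u₀` of `(N, s, J)` -/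

/-- **Taubes's canonical spinor `u₀` of the symplectic `4`-manifold `(N, s)` with compatible `J`**:
the unit section of the trivial summand `I` of `S⁺ = I ⊕ K⁻¹` of the canonical `Spin^c` structure
(Taubes 1995, (5.1); Taubes 1994, §1), i.e. the canonical spinor of the unitary adapted frames.
[cite: Taubes1995, §5 Step 1 (p. 233)] -/
def canonicalSpinor : SpinorField (h.canonicalSpincStructure hs hnd) :=
  (h.unitaryAdaptedFrames hs hnd).canonicalSpinor

/-- The local representatives of `u₀` are `(0, 1; 0, 0)` (definitional). [cite: Taubes1994, §1 (p. 810)] -/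
@[simp] theorem canonicalSpinor_toFun (x₀ x : N) : (h.canonicalSpinor hs hnd).toFun x₀ x = plusUnit := rfl

/-- `u₀` is a positive spinor field. [cite: Taubes1994, §1 (p. 810)] -/
theorem isPlus_canonicalSpinor : (h.canonicalSpinor hs hnd).IsPlus :=
  (h.unitaryAdaptedFrames hs hnd).isPlus_canonicalSpinor

/-- `u₀` is smooth. [cite: Taubes1994, §1 (p. 810)] -/
theorem isSmooth_canonicalSpinor : (h.canonicalSpinor hs hnd).IsSmooth :=
  (h.unitaryAdaptedFrames hs hnd).isSmooth_canonicalSpinor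

/-- **`|u₀| = 1`** ("This section, `u₀`, can be taken to have unit length"). [cite: Taubes1995, §5 Step 1 (p. 233)] -/
@[simp] theorem hermNormSq_canonicalSpinor (x : N) : (h.canonicalSpinor hs hnd).hermNormSq x = 1 :=
  (h.unitaryAdaptedFrames hs hnd).hermNormSq_canonicalSpinor x

/-! ### The eigen-splitting `S⁺ = K⁻¹ ⊕ I` under Clifford multiplication by `s` -/

/-- **`I ∋ u₀` is the `-2i`-eigenspace of `ρ⁺(s)`** (Taubes 1994, §1: "the summand `I` is an
eigenspace for Clifford multiplication by `ω` with eigenvalue `-i`", for his `|ω|² = ½`; here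
`|s|² = 2`). [cite: Taubes1994, §1 (p. 810)] -/
theorem plusAction_symplectic_mulVec_plusUnit (x₀ : N) {x : N}
    (hx : x ∈ (h.canonicalSpincStructure hs hnd).baseSet x₀) :
    Matrix.mulVec (plusAction (twoFormMatrix s x fun k ↦ (h.canonicalSpincStructure hs hnd).frame x₀ k x)) ![0, 1] =
      (-(2 * I)) • (![0, 1] : Fin 2 → ℂ) := by
  rw [h.plusAction_twoFormMatrix_canonicalSpincStructure hs hnd x₀ hx]
  ext a; fin_cases a <;> simp [Matrix.mulVec, dotProduct, Fin.sum_univ_two]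

/-- **`K⁻¹ ∋ u₁` is the `+2i`-eigenspace of `ρ⁺(s)`** ("The summand `K⁻¹` has eigenvalue `+i`").
[cite: Taubes1994, §1 (p. 810)] -/
theorem plusAction_symplectic_mulVec_detUnit (x₀ : N) {x : N}
    (hx : x ∈ (h.canonicalSpincStructure hs hnd).baseSet x₀) :
    Matrix.mulVec (plusAction (twoFormMatrix s x fun k ↦ (h.canonicalSpincStructure hs hnd).frame x₀ k x)) ![1, 0] =
      (2 * I) • (![1, 0] : Fin 2 → ℂ) := by
  rw [h.plusAction_twoFormMatrix_canonicalSpincStructure hs hnd x₀ hx]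
  ext a; fin_cases a <;> simp [Matrix.mulVec, dotProduct, Fin.sum_univ_two]

/-! ### The quadratic term at `c · u₀` is Clifford multiplication by `(|c|²/4) · s` -/

/-- **`q(c·u₀) = (|c|²/2)·diag(-1, 1)`** (`q(ψ) = ψ ⊗ ψ* - ½|ψ|²` at `ψ = (0, c)`; Morgan (7.1) with
`α = c`, `β = 0`). [cite: MorganSWBook1996, §7.1 (7.1)] -/
theorem spinorQuad_canonical (c : ℂ) :
    spinorQuad ![0, c] = ((Complex.normSq c : ℂ) / 2) • !![-1, 0; 0, 1] := by
  rw [spinorQuad_eq]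
  ext a b
  fin_cases a <;> fin_cases b <;> simp
  ring

/-- **`i ρ⁺(t·s) = 2t·diag(-1, 1)`** in every frame of the canonical `Spin^c` structure
(`ρ⁺(s) = diag(2i, -2i)`). [cite: Taubes1995, §2 (2.2) (p. 226)] -/
theorem I_smul_plusAction_twoFormMatrix_smul (t : ℝ) (x₀ : N) {x : N}
    (hx : x ∈ (h.canonicalSpincStructure hs hnd).baseSet x₀) :
    I • plusAction (twoFormMatrix (t • s) x fun k ↦ (h.canonicalSpincStructure hs hnd).frame x₀ k x) =
      ((2 * t : ℝ) : ℂ) • !![-1, 0; 0, 1] := by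
  rw [twoFormMatrix_smul', plusAction_smul, h.plusAction_twoFormMatrix_canonicalSpincStructure hs hnd x₀ hx]
  ext a b
  fin_cases a <;> fin_cases b <;> simp
  all_goals ring_nf
  all_goals simp [I_sq]

/-- **The identity behind Taubes's Step 1: `q(c·u₀) = i ρ⁺((|c|²/4)·s)`** — the quadratic term of the
curvature equation at `ψ = c·u₀` is Clifford multiplication by the self-dual form `(|c|²/4)·s`; for
`c = √r` this is the term `(ir/4)·ω` of Taubes 1995, (5.2) (`¼ τ(ψ ⊗ ψ*)` at `ψ = √r u₀`).
[cite: Taubes1995, §5 Step 1 (5.2)] -/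
theorem spinorQuad_canonical_eq (c : ℂ) (x₀ : N) {x : N}
    (hx : x ∈ (h.canonicalSpincStructure hs hnd).baseSet x₀) :
    spinorQuad ![0, c] =
      I • plusAction (twoFormMatrix ((Complex.normSq c / 4) • s) x
        fun k ↦ (h.canonicalSpincStructure hs hnd).frame x₀ k x) := by
  rw [spinorQuad_canonical, h.I_smul_plusAction_twoFormMatrix_smul hs hnd _ x₀ hx]
  congr 1
  push_cast
  ring

/-! ### The canonical configuration `(A, c · u₀)` -/

/-- **Taubes's canonical configuration `(A, c·u₀)`** of the canonical `Spin^c` structure: a unitary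
connection `A` on `det P̃ = K⁻¹` together with the constant multiple `c·u₀` of the canonical spinor
(Taubes's `(A₀, u₀)` of 1994, (5), and `(A₀, √r u₀)` of 1995, (5.2), for `A = A₀`, `c = √r`).
[cite: Taubes1995, §5 Step 1 (5.2)] -/
def canonicalConfiguration (A : (h.canonicalSpincStructure hs hnd).detLineBundle.Connection) (c : ℂ) :
    (h.canonicalSpincStructure hs hnd).Configuration where
  conn := A
  spinor := (fun _ : N ↦ c) • h.canonicalSpinor hs hnd
  isPlus := (h.isPlus_canonicalSpinor hs hnd).smulFun _
  isSmooth := (h.isSmooth_canonicalSpinor hs hnd).smulFun contMDiff_const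

/-- The connection of the canonical configuration (definitional). [cite: Taubes1995, §5 Step 1 (5.2)] -/
@[simp] theorem canonicalConfiguration_conn (A : (h.canonicalSpincStructure hs hnd).detLineBundle.Connection)
    (c : ℂ) : (h.canonicalConfiguration hs hnd A c).conn = A := rfl

/-- The spinor of the canonical configuration is `c·u₀` chartwise (definitional). [cite: Taubes1995, §5 Step 1 (5.2)] -/
@[simp] theorem canonicalConfiguration_spinor_toFun
    (A : (h.canonicalSpincStructure hs hnd).detLineBundle.Connection) (c : ℂ) (x₀ x : N) :
    (h.canonicalConfiguration hs hnd A c).spinor.toFun x₀ x = c • plusUnit := rfl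

/-- **`ψ⁺ = (0, c)`** for the canonical configuration (`α = c`, `β = 0`). [cite: Taubes1994, §1 (p. 811)] -/
@[simp] theorem plusSpinor_canonicalConfiguration
    (A : (h.canonicalSpincStructure hs hnd).detLineBundle.Connection) (c : ℂ) (x₀ x : N) :
    (h.canonicalConfiguration hs hnd A c).plusSpinor x₀ x = ![0, c] := by
  ext a
  fin_cases a <;> simp [SpincStructure.Configuration.plusSpinor]

/-- **The canonical configuration is irreducible for `c ≠ 0`** (`u₀` vanishes nowhere; Taubes 1994,
proof of Lemma 3: solutions of the perturbed family are never reducible). [cite: Taubes1994, §1 (p. 810)] -/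
theorem isIrreducible_canonicalConfiguration [Nonempty N]
    (A : (h.canonicalSpincStructure hs hnd).detLineBundle.Connection) {c : ℂ} (hc : c ≠ 0) :
    (h.canonicalConfiguration hs hnd A c).IsIrreducible := by
  intro hred
  obtain ⟨x₀⟩ := ‹Nonempty N›
  have h1 := congr_fun (hred x₀ x₀ (h.mem_unitaryNbhd hs x₀)) (Sum.inl 1)
  simp [hc] at h1

/-! ### The equations solved by `(A, c · u₀)` -/

/-- **The curvature equation for `(A, c·u₀)`**: for every perturbation `η`,
`F_A⁺ = q(c·u₀) + i(η - (|c|²/4)·s)` at a point of a chart iff `ρ⁺(F_A) = ρ⁺(η)` there — the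
quadratic term is absorbed by Taubes's shift of the perturbation (`spinorQuad_canonical_eq`).
[cite: Taubes1995, §5 Step 1 (5.2)] -/
theorem curvatureEquationAt_canonicalConfiguration_iff (η : (h.canonicalSpincStructure hs hnd).Perturbation)
    (A : (h.canonicalSpincStructure hs hnd).detLineBundle.Connection) (c : ℂ) (x₀ : N) {x : N}
    (hx : x ∈ (h.canonicalSpincStructure hs hnd).baseSet x₀) :
    SpincStructure.CurvatureEquationAt (η - h.symplecticPerturbation hs hnd (Complex.normSq c / 4))
        (h.canonicalConfiguration hs hnd A c) x₀ x ↔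
      plusAction ((h.canonicalSpincStructure hs hnd).curvatureMatrix A x₀ x) =
        plusAction (twoFormMatrix η.form x fun k ↦ (h.canonicalSpincStructure hs hnd).frame x₀ k x) := by
  unfold SpincStructure.CurvatureEquationAt
  rw [plusSpinor_canonicalConfiguration, h.spinorQuad_canonical_eq hs hnd c x₀ hx, canonicalConfiguration_conn,
    SpincStructure.Perturbation.plusAction_twoFormMatrix_sub, symplecticPerturbation_form, smul_sub,
    add_sub_cancel]
  exact (smul_right_injective (Matrix (Fin 2) (Fin 2) ℂ) I_ne_zero).eq_iff

/-- The local representatives of `c·u₀` have vanishing differential (they are constant). [folklore] -/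
@[simp] theorem spinorDeriv_canonicalConfiguration
    (A : (h.canonicalSpincStructure hs hnd).detLineBundle.Connection) (c : ℂ) (x₀ x : N)
    (v : TangentSpace (𝓡 4) x) :
    spinorDeriv ((h.canonicalConfiguration hs hnd A c).spinor.toFun x₀) x v = 0 := by
  funext a
  simp only [spinorDeriv, canonicalConfiguration_spinor_toFun]
  exact complexDeriv_const _ x v

section Equations

variable [(h.metric hs).HasLeviCivita]

/-- **`∇̃^A_v (c·u₀) = c · ∇̃^A_v u₀`** (both representatives are constant). [cite: MorganSWBook1996, §3.2 (3.2)] -/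
theorem covDeriv_canonicalConfiguration (A : (h.canonicalSpincStructure hs hnd).detLineBundle.Connection)
    (c : ℂ) (x₀ x : N) (v : TangentSpace (𝓡 4) x) :
    SpincStructure.covDeriv A (h.canonicalConfiguration hs hnd A c).spinor x₀ x v =
      c • SpincStructure.covDeriv A (h.canonicalSpinor hs hnd) x₀ x v := by
  rw [SpincStructure.covDeriv, SpincStructure.covDeriv, spinorDeriv_canonicalConfiguration,
    canonicalConfiguration_spinor_toFun, canonicalSpinor,
    (h.unitaryAdaptedFrames hs hnd).spinorDeriv_canonicalSpinor, AdaptedFrames.canonicalSpinor_toFun,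
    zero_add, zero_add, smul_add, Matrix.mulVec_smul, smul_comm]

/-- **`∂_A (c·u₀) = c · ∂_A u₀`.** [cite: MorganSWBook1996, §3.3 (3.3)] -/
theorem dirac_canonicalConfiguration (A : (h.canonicalSpincStructure hs hnd).detLineBundle.Connection)
    (c : ℂ) (x₀ x : N) :
    SpincStructure.dirac A (h.canonicalConfiguration hs hnd A c).spinor x₀ x =
      c • SpincStructure.dirac A (h.canonicalSpinor hs hnd) x₀ x := by
  simp only [SpincStructure.dirac, covDeriv_canonicalConfiguration, Matrix.mulVec_smul, Finset.smul_sum]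

/-- **The Seiberg–Witten equations for `(A, c·u₀)` at a point of a chart**: with the perturbation
`η - (|c|²/4)·s` they hold iff `ρ⁺(F_A) = ρ⁺(η)` (the reducible `(A, 0)` solves `(SW_η)` there) and
`c·∂_A u₀ = 0`. [cite: Taubes1995, §5 Step 1 (5.2)] -/
theorem isSolutionAt_canonicalConfiguration_iff (η : (h.canonicalSpincStructure hs hnd).Perturbation)
    (A : (h.canonicalSpincStructure hs hnd).detLineBundle.Connection) (c : ℂ) (x₀ : N) {x : N}
    (hx : x ∈ (h.canonicalSpincStructure hs hnd).baseSet x₀) :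
    SpincStructure.IsSolutionAt (η - h.symplecticPerturbation hs hnd (Complex.normSq c / 4))
        (h.canonicalConfiguration hs hnd A c) x₀ x ↔
      SpincStructure.IsSolutionAt η (SpincStructure.Configuration.ofConnection A) x₀ x ∧
        c • SpincStructure.dirac A (h.canonicalSpinor hs hnd) x₀ x = 0 := by
  rw [SpincStructure.isSolutionAt_iff_curvatureEquationAt, h.curvatureEquationAt_canonicalConfiguration_iff hs hnd
    η A c x₀ hx, SpincStructure.isSolutionAt_ofConnection_iff, canonicalConfiguration_conn, dirac_canonicalConfiguration]

/-- **Taubes's canonical solution (Taubes 1994, (5); Taubes 1995, (5.2)).**  Let `A` be a unitary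
connection on `det P̃ = K⁻¹` of the canonical `Spin^c` structure of `(N, s, J)`, let `η_A` be a
perturbation with `ρ⁺(F_A) = ρ⁺(η_A)` on every chart (the self-dual part of the curvature of `A` as a
perturbation, i.e. `(A, 0)` solves `(SW_{η_A})`), and suppose `∂_A u₀ = 0`.  Then for every `c ∈ ℂ` the
configuration `(A, c·u₀)` solves the Seiberg–Witten equations with perturbation `η_A - (|c|²/4)·s`:
`∂_A(c u₀) = 0` and `F_A⁺ = q(c u₀) + i(η_A - (|c|²/4)s)`.  For Taubes's connection `A = A₀` (local
forms `AdaptedFrames.canonicalForm`; `∂_{A₀} u₀ = 0` is his Lemma 1, `dω = 0`) and `c = √r` this is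
"the pair `(A₀, u₀)` is, by construction, a solution to (5)" / `(A₀, √r u₀)` solves (5.2).
[cite: Taubes1994, §1 (5) (p. 811)] [cite: Taubes1995, §5 Step 1 (5.2) (p. 233)] -/
theorem isSolution_canonicalConfiguration (η_A : (h.canonicalSpincStructure hs hnd).Perturbation)
    (A : (h.canonicalSpincStructure hs hnd).detLineBundle.Connection)
    (hA : SpincStructure.IsSolution η_A (SpincStructure.Configuration.ofConnection A))
    (hD : ∀ x₀, ∀ x ∈ (h.canonicalSpincStructure hs hnd).baseSet x₀,
      SpincStructure.dirac A (h.canonicalSpinor hs hnd) x₀ x = 0)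
    (c : ℂ) :
    SpincStructure.IsSolution (η_A - h.symplecticPerturbation hs hnd (Complex.normSq c / 4))
      (h.canonicalConfiguration hs hnd A c) :=
  fun x₀ x hx ↦ (h.isSolutionAt_canonicalConfiguration_iff hs hnd η_A A c x₀ hx).2
    ⟨hA x₀ x hx, by rw [hD x₀ x hx, smul_zero]⟩

/-- Conversely, **if `(A, c·u₀)` with `c ≠ 0` solves `(SW_{η - (|c|²/4)s})` then `(A, 0)` solves
`(SW_η)` and `∂_A u₀ = 0`.** [cite: Taubes1995, §5 Step 1 (5.2)] -/
theorem isSolution_ofConnection_of_isSolution_canonicalConfiguration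
    (η : (h.canonicalSpincStructure hs hnd).Perturbation)
    (A : (h.canonicalSpincStructure hs hnd).detLineBundle.Connection) {c : ℂ} (hc : c ≠ 0)
    (hsol : SpincStructure.IsSolution (η - h.symplecticPerturbation hs hnd (Complex.normSq c / 4))
      (h.canonicalConfiguration hs hnd A c)) :
    SpincStructure.IsSolution η (SpincStructure.Configuration.ofConnection A) ∧
      ∀ x₀, ∀ x ∈ (h.canonicalSpincStructure hs hnd).baseSet x₀,
        SpincStructure.dirac A (h.canonicalSpinor hs hnd) x₀ x = 0 := by
  refine ⟨fun x₀ x hx ↦ ((h.isSolutionAt_canonicalConfiguration_iff hs hnd η A c x₀ hx).1 (hsol x₀ x hx)).1,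
    fun x₀ x hx ↦ ?_⟩
  have h2 := ((h.isSolutionAt_canonicalConfiguration_iff hs hnd η A c x₀ hx).1 (hsol x₀ x hx)).2
  exact (smul_eq_zero.1 h2).resolve_left hc

end Equations

/-! ### Taubes's connection `A₀` of `(N, s, J)` -/

section TaubesConnection

variable [(h.metric hs).HasLeviCivita]

/-- **Taubes's connection `A₀` on `K⁻¹ = det P̃`** of the canonical `Spin^c` structure of `(N, s, J)`:
"the bundle `K⁻¹` has a unique connection (up to gauge equivalence), `A₀`, … the composition of the
spin covariant derivative with orthogonal projection onto the `I` summand … annihilates a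
nowhere-vanishing section", `u₀` — the canonical connection of the unitary adapted frames.
[cite: Taubes1995, §5 Step 1 (p. 233)] -/
def taubesConnection : (h.canonicalSpincStructure hs hnd).detLineBundle.Connection :=
  (h.unitaryAdaptedFrames hs hnd).canonicalConnection

/-- The local forms of `A₀` are `A₀ᵢ = -2 Im dρ(ω̃^{(i)})_{u₀u₀}`. [cite: Taubes1994, §1 (p. 810)] -/
@[simp] theorem taubesConnection_form (x₀ x : N) (v : TangentSpace (𝓡 4) x) :
    (h.taubesConnection hs hnd).form x₀ x v = (h.unitaryAdaptedFrames hs hnd).canonicalFormFun x₀ x v :=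
  (h.unitaryAdaptedFrames hs hnd).canonicalConnection_form x₀ x v

/-- **Taubes's (1) for `(N, s, J)`: `∇̃^{A₀}_v u₀ = b(v) u₁`.** [cite: Taubes1994, §1 (1)] -/
theorem covDeriv_taubesConnection_canonicalSpinor (x₀ x : N) (v : TangentSpace (𝓡 4) x) :
    SpincStructure.covDeriv (h.taubesConnection hs hnd) (h.canonicalSpinor hs hnd) x₀ x v =
      (h.unitaryAdaptedFrames hs hnd).canonicalTorsion x₀ x v • detUnit :=
  (h.unitaryAdaptedFrames hs hnd).covDeriv_canonicalConnection_canonicalSpinor x₀ x v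

/-- The `I`-component of `∇̃^{A₀} u₀` vanishes: `∇_{A₀}` annihilates `u₀` on the summand `I`.
[cite: Taubes1995, §5 Step 1 (p. 233)] -/
@[simp] theorem covDeriv_taubesConnection_canonicalSpinor_inl_one (x₀ x : N) (v : TangentSpace (𝓡 4) x) :
    SpincStructure.covDeriv (h.taubesConnection hs hnd) (h.canonicalSpinor hs hnd) x₀ x v (Sum.inl 1) = 0 :=
  (h.unitaryAdaptedFrames hs hnd).covDeriv_canonicalConnection_canonicalSpinor_inl_one x₀ x v

/-- **Uniqueness of `A₀`**: a unitary connection on `K⁻¹` whose covariant derivative annihilates `u₀`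
on the summand `I` has the local forms of `A₀` ("a unique connection (up to gauge equivalence)"; for
the fixed Čech cocycle the local forms themselves agree). [cite: Taubes1995, §5 Step 1 (p. 233)] -/
theorem taubesConnection_unique (A : (h.canonicalSpincStructure hs hnd).detLineBundle.Connection)
    (hA : ∀ x₀ x (v : TangentSpace (𝓡 4) x),
      SpincStructure.covDeriv A (h.canonicalSpinor hs hnd) x₀ x v (Sum.inl 1) = 0) :
    A.form = (h.taubesConnection hs hnd).form := by
  funext x₀ x
  ext v
  exact (h.unitaryAdaptedFrames hs hnd).form_eq_canonicalConnection_form A hA x₀ x v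

/-- **`∂_{A₀} u₀ = 0 ↔ b₀ = i b₁ ∧ b₂ = i b₃`** in every unitary frame (`b_k = b(e_k)`): the Dirac
equation for `u₀` is the type-`(0,1)` condition on Taubes's torsion (Taubes 1994, (3); by his Lemma 1
it holds since `ds = 0`). [cite: Taubes1994, §1 (3)] -/
theorem dirac_taubesConnection_canonicalSpinor_eq_zero_iff (x₀ x : N) :
    SpincStructure.dirac (h.taubesConnection hs hnd) (h.canonicalSpinor hs hnd) x₀ x = 0 ↔
      (h.unitaryAdaptedFrames hs hnd).canonicalTorsion x₀ x ((h.canonicalSpincStructure hs hnd).frame x₀ 0 x) =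
          I * (h.unitaryAdaptedFrames hs hnd).canonicalTorsion x₀ x ((h.canonicalSpincStructure hs hnd).frame x₀ 1 x) ∧
        (h.unitaryAdaptedFrames hs hnd).canonicalTorsion x₀ x ((h.canonicalSpincStructure hs hnd).frame x₀ 2 x) =
          I * (h.unitaryAdaptedFrames hs hnd).canonicalTorsion x₀ x ((h.canonicalSpincStructure hs hnd).frame x₀ 3 x) :=
  (h.unitaryAdaptedFrames hs hnd).dirac_canonicalConnection_canonicalSpinor_eq_zero_iff x₀ x

/-- **Taubes's canonical solution `(A₀, √r u₀)` (Taubes 1994, (5); Taubes 1995, (5.2)) for Taubes's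
connection.**  If `η₀` is a perturbation with `ρ⁺(F_{A₀}) = ρ⁺(η₀)` on every chart (`F⁺_{A₀}` as a
perturbation: `(A₀, 0)` solves `(SW_{η₀})`) and `∂_{A₀} u₀ = 0` (Taubes's Lemma 1, from `ds = 0`), then
for every `c` the configuration `(A₀, c·u₀)` solves the Seiberg–Witten equations with perturbation
`η₀ - (|c|²/4)·s` — for `c = √r`, `P₊F_A = ¼τ(ψ ⊗ ψ*) + P₊F_{A₀} - (ir/4)ω`, `D_A ψ = 0`.
[cite: Taubes1995, §5 Step 1 (5.2) (p. 233)] -/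
theorem isSolution_canonicalConfiguration_taubesConnection
    (η₀ : (h.canonicalSpincStructure hs hnd).Perturbation)
    (hη : SpincStructure.IsSolution η₀ (SpincStructure.Configuration.ofConnection (h.taubesConnection hs hnd)))
    (hD : ∀ x₀, ∀ x ∈ (h.canonicalSpincStructure hs hnd).baseSet x₀,
      SpincStructure.dirac (h.taubesConnection hs hnd) (h.canonicalSpinor hs hnd) x₀ x = 0)
    (c : ℂ) :
    SpincStructure.IsSolution (η₀ - h.symplecticPerturbation hs hnd (Complex.normSq c / 4))
      (h.canonicalConfiguration hs hnd (h.taubesConnection hs hnd) c) :=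
  h.isSolution_canonicalConfiguration hs hnd η₀ _ hη hD c

end TaubesConnection

/-! ### Taubes's Lemma 1 for `(N, s, J)`: `ds = 0 ⇒ ∂_{A₀} u₀ = 0`, and the canonical solution -/

section LemmaOne

variable [(h.metric hs).HasLeviCivita]

/-- **`(N, g_J, J)` is quasi-Kähler when `ds = 0`** (almost Kähler ⇒ quasi-Kähler, Gray–Hervella;
`GaugeTheory/AdaptedFramesQuasiKaehler`): for every unitary chart `x₀`, `x ∈ U_{x₀}` and `v ∈ T_x N`,
Taubes's vector `w(v) = (∇_v J) e₀` satisfies `w(Jv) = -J w(v)`. [cite: Taubes1994, §1 Lemma 1 (p. 811)] -/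
theorem frameTorsionVec_map_eq_neg_map (hcl : IsClosedForm s) (x₀ : N) {x : N}
    (hx : x ∈ (h.canonicalSpincStructure hs hnd).baseSet x₀) (v : TangentSpace (𝓡 4) x) :
    (h.unitaryAdaptedFrames hs hnd).frameTorsionVec x₀ x (J x v) =
      -J x ((h.unitaryAdaptedFrames hs hnd).frameTorsionVec x₀ x v) :=
  (h.unitaryAdaptedFrames hs hnd).frameTorsionVec_map_eq_neg_map x₀ hx s hs hcl
    (fun y _ v w ↦ h.form_eq_metric_val_map hs y v w) v

/-- **Taubes's Lemma 1 (`⇒`) for `(N, s, J)`: `∂_{A₀} u₀ = 0`.**  Since `s` is closed, the canonical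
spinor `u₀` is harmonic for Taubes's connection `A₀` on every unitary chart — "The form `ω` is closed
if and only if `u₀` solves the Dirac equation" (Taubes 1994, §1, Lemma 1), "the section `u₀` of `I` …
is annihilated by the Dirac operator `D_{A₀}`" (Taubes 1995, §5 Step 1, p. 233).
[cite: Taubes1994, §1 Lemma 1 (p. 811)] [cite: Taubes1995, §5 Step 1 (p. 233)] -/
theorem dirac_taubesConnection_canonicalSpinor_eq_zero (hcl : IsClosedForm s) (x₀ : N) {x : N}
    (hx : x ∈ (h.canonicalSpincStructure hs hnd).baseSet x₀) :
    SpincStructure.dirac (h.taubesConnection hs hnd) (h.canonicalSpinor hs hnd) x₀ x = 0 :=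
  (h.unitaryAdaptedFrames hs hnd).dirac_canonicalConnection_canonicalSpinor_eq_zero_of_isClosedForm x₀ hx s hs
    hcl fun y _ v w ↦ h.form_eq_metric_val_map hs y v w

/-- **Taubes's canonical solution `(A₀, √r u₀)` of `(N, s, J)` with `ds = 0` (Taubes 1994, (5);
Taubes 1995, (5.2)).**  If `η₀` is a perturbation with `ρ⁺(F_{A₀}) = ρ⁺(η₀)` on every chart
(`F⁺_{A₀}` as a perturbation), then for every `c` the configuration `(A₀, c·u₀)` solves the
Seiberg–Witten equations with perturbation `η₀ - (|c|²/4)·s`; the Dirac equation `∂_{A₀}(c u₀) = 0`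
now holds unconditionally, by Lemma 1 (`dirac_taubesConnection_canonicalSpinor_eq_zero`).
[cite: Taubes1995, §5 Step 1 (5.2) (p. 233)] [cite: Taubes1994, §1 (5) (p. 811)] -/
theorem isSolution_canonicalConfiguration_taubesConnection_of_isClosedForm (hcl : IsClosedForm s)
    (η₀ : (h.canonicalSpincStructure hs hnd).Perturbation)
    (hη : SpincStructure.IsSolution η₀ (SpincStructure.Configuration.ofConnection (h.taubesConnection hs hnd)))
    (c : ℂ) :
    SpincStructure.IsSolution (η₀ - h.symplecticPerturbation hs hnd (Complex.normSq c / 4))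
      (h.canonicalConfiguration hs hnd (h.taubesConnection hs hnd) c) :=
  h.isSolution_canonicalConfiguration_taubesConnection hs hnd η₀ hη
    (fun x₀ _ hx ↦ h.dirac_taubesConnection_canonicalSpinor_eq_zero hs hnd hcl x₀ hx) c

end LemmaOne

end AlmostComplexStructure.IsCompatibleWith

end Literature.Geometry.Symplectic

end
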